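import Summits.Langlands.Langlands.Theorems.IrreducibilityBySelfDualityPairLBoundaryJS
import Summits.Langlands.Langlands.Theorems.IrreducibilityBySelfDualityPairLBoundaryJSSsv
import Summits.Langlands.Langlands.Theorems.IrreducibilityBySelfDualityPairLBoundaryJSStandardEntire
import Summits.Langlands.Langlands.Theorems.IrreducibilityBySelfDualityPairLBoundaryJSIsOrthoOfLocalTranslate
import Summits.Langlands.Langlands.Theorems.IrreducibilityBySelfDualityPairLBoundaryJSEqConjOfLocalTranslate
import Summits.Langlands.Langlands.Theorems.IrreducibilityBySelfDualityPairLBoundaryJSLocalPairTranslate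
import Summits.Langlands.Langlands.Theorems.IrreducibilityBySelfDualityPairLBoundaryJSOfHumphriesJo
import Summits.Langlands.Langlands.Theorems.IrreducibilityBySelfDualityPairLBoundaryJSCornerBochnerIwasawa
import Summits.Langlands.Langlands.Theorems.IrreducibilityBySelfDualityPairLBoundaryJSCornerPairTranslate
import Summits.Langlands.Langlands.Theorems.IrreducibilityBySelfDualityPairLBoundaryJSCornerPairEuler
import Summits.Langlands.Langlands.Theorems.IrreducibilityBySelfDualityPairLBoundaryJSCornerAbsMajorant
import Summits.Langlands.Langlands.Theorems.IrreducibilityBySelfDualityPairLBoundaryJSCornerAbsIdeleMoment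
import Summits.Langlands.Langlands.Theorems.IrreducibilityBySelfDualityPairLBoundaryJSCornerAbsTorusMajorant
import Summits.Langlands.Langlands.Theorems.IrreducibilityBySelfDualityPairLBoundaryJSCornerAbsConvergence
import Summits.Langlands.Langlands.Theorems.IrreducibilityBySelfDualityPairLBoundaryJSCornerEulerLimit
import Summits.Langlands.Langlands.Theorems.IrreducibilityBySelfDualityPairLBoundaryJSHonestTranslateUnramified
import Summits.Langlands.Langlands.Theorems.IrreducibilityBySelfDualityPairLBoundaryJSCornerGlobal
import Literature.NumberTheory.Automorphic.PairLFunctionMeromorphicContinuationRankNeTwistProofs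
import Literature.NumberTheory.Automorphic.ArchRankinSelbergCornerTestVector
import Literature.NumberTheory.Automorphic.ClozelAlgebraicityComplexConjProofs
import Literature.NumberTheory.Automorphic.AutomorphicConjugate
import Literature.NumberTheory.Automorphic.ArchRankinSelbergTestVector
import Literature.NumberTheory.Automorphic.JPSSGlobalIntegralQuotientUnfolding
import Literature.NumberTheory.Automorphic.JPSSCornerWhittakerUnfolding
import Literature.NumberTheory.Automorphic.WhittakerPeriodExchange
import Literature.NumberTheory.Automorphic.TorusIwasawaTransport
import Literature.NumberTheory.Automorphic.CornerTorusIwasawaData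
import Literature.NumberTheory.Automorphic.WhittakerCoeffHonestCuspForm
import Literature.NumberTheory.Automorphic.WhittakerCoeffTranslateUnramified
import Literature.NumberTheory.Automorphic.WhittakerDecayCuspForm
import Literature.NumberTheory.Automorphic.WhittakerSupportFinite
import Literature.NumberTheory.Automorphic.RankinSelbergUnramifiedTorus
import Literature.NumberTheory.Automorphic.RankinSelbergTorusPairEuler
import Literature.NumberTheory.Automorphic.RankinSelbergTowerFiniteness
import Literature.NumberTheory.Automorphic.RankinSelbergTorusPairTranslate
import Literature.NumberTheory.Automorphic.WhittakerTowerCoeff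

/-!
# The torus substitution `a ↦ τ a` in the unfolded `GL_{m+1} × GL_m` corner integral (part 1 of W-CGT)

Summit `Langlands`, sub-problem `Langlands`, helper file under `Theorems/` supporting the crux
`PairLBoundaryJS` (stmt-Langlands-13622), line `Sketch`: the first part of the registered stub
`stub_corner_global_translate` (W-CGT, file `…PairLBoundaryJSCornerGlobalTranslate`), registered as the
sub-stub `stub_corner_integral_translate`. For Whittaker-type functions `W₁` on `GL_{m+1}(𝔸_K)`, `W₂` on
`GL_m(𝔸_K)`, a torus element `τ ∈ (𝔸_Kˣ)ᵐ` (NO condition on its last entry: the test function of the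
corner integrand is `1`) and the corner pair integrand
`I_s(a, k) = W₁(ι(diag(a) k)) W₂(diag(a) k) |det a|^s δ_{B_m}(a)⁻¹` (`ι = glCorner = diag(·, 1)`):

* `I_s(τ a, k) = w_s(τ) I^τ_s(a, k)` with `I^τ` the corner integrand of `W₁(diag(τ, 1) ·)`, `W₂(diag τ ·)`
  (`torusPairIntegrandC_corner_translate`: `diag(τ a) k = diag τ · diag(a) k`, `ι(diag τ) = diag(τ, 1)`,
  `glCorner_glDiagonal_eq_glDiagonal_snoc`, multiplicativity of the weight `torusWeightC_mul`);
* `∫ I_s d(νA ⊗ νK) = w_s(τ) ∫ I^τ_s d(νA ⊗ νK)` for `νA` left invariant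
  (`integral_torusPairIntegrandC_corner_translate`, the pattern of
  `rankinSelbergTorusPairIntegralC_eq_torusWeightC_mul_translate`), and integrability transfers
  (`integrable_torusPairIntegrandC_corner_translate`);
* the conductor bookkeeping `diag(τ, 1)_v = diag(d) ⇒ (diag τ)_v = diag(d ∘ castSucc)`
  (`localComponent_glDiagonal_eq_of_snoc`).

This is the change of variables of Cogdell (2004), §3.1, Thm. 3.3 ("translate the essential vector") along
the corner.

## References

* J. W. Cogdell, *Analytic theory of L-functions for GL_n*, in *An Introduction to the Langlands
  Program* (2004), §2.3 Thm. 2.2, §3.1 Thm. 3.3 [CogdellAnalyticTheory2004].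
* H. Jacquet, I. I. Piatetski-Shapiro, J. Shalika, *Rankin–Selberg convolutions*, Amer. J. Math.
  105 (1983), §2 [JacquetPiatetskiShapiroShalika1983].
-/

noncomputable section

-- `Summit.Langlands.Langlands.…` (summit = sub-problem name, D-0017 layout) trips `dupNamespace`
set_option linter.dupNamespace false

open scoped MatrixGroups Topology Pointwise ENNReal NNReal ComplexConjugate InnerProductSpace ContDiff
-- the place subtypes indexing `mixedSpace K` are `Fintype` classically (`NormedCommRing (mixedSpace K)`)
open scoped Classical Matrix.Norms.Operator
open NumberField IsDedekindDomain MeasureTheory Measure Matrix Set Filter WithZero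
open NumberField.mixedEmbedding
open Literature.NumberTheory.Automorphic AdelicGroupData
open Literature.NumberTheory.GaloisRepresentations (ideleGroup HeckeCharacter)
open Literature.MeasureTheory.Group
open Literature.RingTheory.SymmetricFunctions.SymmPoly
open ValuativeRel

-- the automorphic quotient carries the tree's Borel σ-algebra, not Mathlib's quotient σ-algebra
attribute [-instance] Quotient.instMeasurableSpace QuotientGroup.measurableSpace

-- the house local instances, exactly as in `RankinSelbergUnfoldingIdentity`
attribute [local instance] adelicBorel borelSpace_adelic locallyCompactSpace_adelic secondCountableTopology_gl_adelic
  glAdeleBorel borelSpace_glAdele borelSpace_ideleGroup secondCountableTopology_ideleGroup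

-- Mathlib idiom: the commutator Lie ring on matrices, to mention `(archGroupGL n K).lie`
attribute [local instance 100] LieRing.ofAssociativeRing

namespace Summit.Langlands.Langlands.Theorems.CornerGlobalTranslatePart1

/-! ### The torus substitution `a ↦ τ a` in the corner pair integrand -/

section Translate

variable {m : ℕ} {K : Type} [Field K] [NumberField K]

local notation "𝔸" => AdeleRing (𝓞 K) K

/-- **The corner pair integrand at a translated torus point**: for `τ ∈ (𝔸_Kˣ)ᵐ` (no condition on its
last entry, the test function being `1`), `I_s(τ a, k) = w_s(τ) · I^τ_s(a, k)` where `I^τ` is the corner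
integrand of the left translates `W₁(diag(τ, 1) ·)`, `W₂(diag τ ·)` (`diag(τ a) k = diag τ · diag(a) k`,
`ι(diag τ) = diag(τ, 1)`, multiplicativity of the weight). [folklore] -/
theorem torusPairIntegrandC_corner_translate (W₁ : GL (Fin (m + 1)) 𝔸 → ℂ) (W₂ : GL (Fin m) 𝔸 → ℂ)
    (τ : Fin m → ideleGroup K) (s : ℂ) (p : (Fin m → ideleGroup K) × ↥(maximalCompactAdelic m K)) :
    torusPairIntegrandC m K (fun g => W₁ (glCorner 𝔸 (Nat.le_succ m) g)) W₂ (fun _ => (1 : ℝ)) s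
        (τ * p.1, p.2) =
      torusWeightC m K s τ * torusPairIntegrandC m K
        (fun g => W₁ (glDiagonal (m + 1) 𝔸 (Fin.snoc τ 1) * glCorner 𝔸 (Nat.le_succ m) g))
        (fun g => W₂ (glDiagonal m 𝔸 τ * g)) (fun _ => (1 : ℝ)) s p := by
  obtain ⟨a, k⟩ := p
  simp only [torusPairIntegrandC]
  rw [torusPoint_mul, map_mul, glCorner_glDiagonal_eq_glDiagonal_snoc, torusWeightC_mul]
  ring

variable [MeasurableSpace (AdeleRing (𝓞 K) K)] [BorelSpace (AdeleRing (𝓞 K) K)]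
variable (νA : Measure (Fin m → ideleGroup K)) [νA.IsMulLeftInvariant] [SFinite νA]
  (νK : Measure ↥(maximalCompactAdelic m K)) [SFinite νK]

/-- **Substituting `a ↦ τ a` in the corner pair integral**:
`∫ I_s d(νA ⊗ νK) = w_s(τ) · ∫ I^τ_s d(νA ⊗ νK)` (left invariance of `νA`; no integrability needed).
[cite: CogdellAnalyticTheory2004, §3.1, Thm. 3.3] -/
theorem integral_torusPairIntegrandC_corner_translate (W₁ : GL (Fin (m + 1)) 𝔸 → ℂ) (W₂ : GL (Fin m) 𝔸 → ℂ)
    (τ : Fin m → ideleGroup K) (s : ℂ) :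
    ∫ p, torusPairIntegrandC m K (fun g => W₁ (glCorner 𝔸 (Nat.le_succ m) g)) W₂ (fun _ => (1 : ℝ)) s p
        ∂(νA.prod νK) =
      torusWeightC m K s τ * ∫ p, torusPairIntegrandC m K
        (fun g => W₁ (glDiagonal (m + 1) 𝔸 (Fin.snoc τ 1) * glCorner 𝔸 (Nat.le_succ m) g))
        (fun g => W₂ (glDiagonal m 𝔸 τ * g)) (fun _ => (1 : ℝ)) s p ∂(νA.prod νK) := by
  let e : (Fin m → ideleGroup K) × ↥(maximalCompactAdelic m K) ≃ᵐ
      (Fin m → ideleGroup K) × ↥(maximalCompactAdelic m K) :=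
    (MeasurableEquiv.mulLeft τ).prodCongr (MeasurableEquiv.refl _)
  have he : ⇑e = Prod.map (τ * ·) id := rfl
  have hmp : MeasurePreserving e (νA.prod νK) (νA.prod νK) := by
    rw [he]; exact measurePreserving_prodMap_mul_left νA νK τ
  calc ∫ p, torusPairIntegrandC m K (fun g => W₁ (glCorner 𝔸 (Nat.le_succ m) g)) W₂ (fun _ => (1 : ℝ)) s p
        ∂(νA.prod νK)
      = ∫ p, torusPairIntegrandC m K (fun g => W₁ (glCorner 𝔸 (Nat.le_succ m) g)) W₂ (fun _ => (1 : ℝ)) s (e p)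
          ∂(νA.prod νK) := (hmp.integral_comp e.measurableEmbedding _).symm
    _ = ∫ p, torusWeightC m K s τ * torusPairIntegrandC m K
          (fun g => W₁ (glDiagonal (m + 1) 𝔸 (Fin.snoc τ 1) * glCorner 𝔸 (Nat.le_succ m) g))
          (fun g => W₂ (glDiagonal m 𝔸 τ * g)) (fun _ => (1 : ℝ)) s p ∂(νA.prod νK) :=
        integral_congr_ae (Eventually.of_forall fun p => torusPairIntegrandC_corner_translate W₁ W₂ τ s p)
    _ = _ := integral_const_mul _ _

/-- **Integrability transfers to the translated corner pair integrand.** [folklore] -/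
theorem integrable_torusPairIntegrandC_corner_translate (W₁ : GL (Fin (m + 1)) 𝔸 → ℂ)
    (W₂ : GL (Fin m) 𝔸 → ℂ) (τ : Fin m → ideleGroup K) {s : ℂ}
    (hint : Integrable (torusPairIntegrandC m K (fun g => W₁ (glCorner 𝔸 (Nat.le_succ m) g)) W₂
      (fun _ => (1 : ℝ)) s) (νA.prod νK)) :
    Integrable (torusPairIntegrandC m K
      (fun g => W₁ (glDiagonal (m + 1) 𝔸 (Fin.snoc τ 1) * glCorner 𝔸 (Nat.le_succ m) g))
      (fun g => W₂ (glDiagonal m 𝔸 τ * g)) (fun _ => (1 : ℝ)) s) (νA.prod νK) := by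
  let e : (Fin m → ideleGroup K) × ↥(maximalCompactAdelic m K) ≃ᵐ
      (Fin m → ideleGroup K) × ↥(maximalCompactAdelic m K) :=
    (MeasurableEquiv.mulLeft τ).prodCongr (MeasurableEquiv.refl _)
  have he : ⇑e = Prod.map (τ * ·) id := rfl
  have hmp : MeasurePreserving e (νA.prod νK) (νA.prod νK) := by
    rw [he]; exact measurePreserving_prodMap_mul_left νA νK τ
  have hcomp : Integrable (torusPairIntegrandC m K (fun g => W₁ (glCorner 𝔸 (Nat.le_succ m) g)) W₂
      (fun _ => (1 : ℝ)) s ∘ e) (νA.prod νK) :=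
    (hmp.integrable_comp_emb e.measurableEmbedding).2 hint
  have heq : (fun p => (torusWeightC m K s τ)⁻¹ *
      (torusPairIntegrandC m K (fun g => W₁ (glCorner 𝔸 (Nat.le_succ m) g)) W₂ (fun _ => (1 : ℝ)) s ∘ e) p) =
      torusPairIntegrandC m K
        (fun g => W₁ (glDiagonal (m + 1) 𝔸 (Fin.snoc τ 1) * glCorner 𝔸 (Nat.le_succ m) g))
        (fun g => W₂ (glDiagonal m 𝔸 τ * g)) (fun _ => (1 : ℝ)) s := by
    funext p
    rw [Function.comp_apply, he, show Prod.map (τ * ·) id p = (τ * p.1, p.2) from rfl,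
      torusPairIntegrandC_corner_translate W₁ W₂ τ s p, ← mul_assoc,
      inv_mul_cancel₀ (torusWeightC_ne_zero s τ), one_mul]
  rw [← heq]
  exact hcomp.const_mul _

end Translate

/-! ### The conductor clauses of `diag τ` from those of `diag(τ, 1)` -/

section Conductor

variable {m : ℕ} {K : Type} [Field K] [NumberField K]

local notation "𝔸" => AdeleRing (𝓞 K) K

/-- The `v`-component of `diag(e)` is `diag(e_v)`. [folklore] -/
theorem localComponent_glDiagonal {n : ℕ} (v : HeightOneSpectrum (𝓞 K)) (e : Fin n → ideleGroup K) :
    localComponent v (glDiagonal n 𝔸 e) =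
      diagonalGL (Fin n) (v.adicCompletion K) fun i => Units.map (AdelicGroupData.adeleEval K v).toMonoidHom (e i) :=
  generalLinearGroup_map_glDiagonal _ e

/-- **The `v`-component of `diag τ` from that of `diag(τ, 1)`**: if `diag(τ, 1)_v = diag(d)` then
`(diag τ)_v = diag(d ∘ castSucc)`. [folklore] -/
theorem localComponent_glDiagonal_eq_of_snoc {v : HeightOneSpectrum (𝓞 K)} {τ : Fin m → ideleGroup K}
    {d : Fin (m + 1) → (v.adicCompletion K)ˣ}
    (hT : localComponent v (glDiagonal (m + 1) 𝔸 (Fin.snoc τ 1)) = diagonalGL (Fin (m + 1)) (v.adicCompletion K) d) :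
    localComponent v (glDiagonal m 𝔸 τ) = diagonalGL (Fin m) (v.adicCompletion K) fun i => d (Fin.castSucc i) := by
  rw [localComponent_glDiagonal] at hT ⊢
  have hd := diagonalGL_injective hT
  congr 1
  funext i
  rw [← hd]
  simp only [Fin.snoc_castSucc]

end Conductor

/-! ### The registered sub-stub -/

/-- **SUB-STUB (W-CGT, part 1) — the torus substitution `a ↦ τ a` in the corner pair integral**: for `νA`
left invariant and s-finite, `νK` s-finite, `W₁` on `GL_{m+1}(𝔸_K)`, `W₂` on `GL_m(𝔸_K)`, `τ ∈ (𝔸_Kˣ)ᵐ` and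
`s ∈ ℂ`: (i) `∫ I_s = w_s(τ) ∫ I^τ_s`; (ii) integrability of `I_s` implies that of `I^τ_s`; (iii) if
`diag(τ, 1)_v = diag(d)` then `(diag τ)_v = diag(d ∘ castSucc)` (Cogdell (2004), §3.1, Thm. 3.3).
[cite: CogdellAnalyticTheory2004, §3.1, Thm. 3.3] -/
theorem stub_corner_integral_translate :
    ∀ {m : ℕ} {K : Type} [Field K] [NumberField K]
      [MeasurableSpace (AdeleRing (𝓞 K) K)] [BorelSpace (AdeleRing (𝓞 K) K)]
      (νA : Measure (Fin m → ideleGroup K)) [νA.IsMulLeftInvariant] [SFinite νA]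
      (νK : Measure ↥(maximalCompactAdelic m K)) [SFinite νK]
      (W₁ : GL (Fin (m + 1)) (AdeleRing (𝓞 K) K) → ℂ) (W₂ : GL (Fin m) (AdeleRing (𝓞 K) K) → ℂ)
      (τ : Fin m → ideleGroup K) (s : ℂ),
    (∫ p, torusPairIntegrandC m K (fun g => W₁ (glCorner (AdeleRing (𝓞 K) K) (Nat.le_succ m) g)) W₂
        (fun _ => (1 : ℝ)) s p ∂(νA.prod νK) =
      torusWeightC m K s τ * ∫ p, torusPairIntegrandC m K
        (fun g => W₁ (glDiagonal (m + 1) (AdeleRing (𝓞 K) K) (Fin.snoc τ 1) *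
          glCorner (AdeleRing (𝓞 K) K) (Nat.le_succ m) g))
        (fun g => W₂ (glDiagonal m (AdeleRing (𝓞 K) K) τ * g)) (fun _ => (1 : ℝ)) s p ∂(νA.prod νK)) ∧
    (Integrable (torusPairIntegrandC m K (fun g => W₁ (glCorner (AdeleRing (𝓞 K) K) (Nat.le_succ m) g)) W₂
        (fun _ => (1 : ℝ)) s) (νA.prod νK) →
      Integrable (torusPairIntegrandC m K
        (fun g => W₁ (glDiagonal (m + 1) (AdeleRing (𝓞 K) K) (Fin.snoc τ 1) *
          glCorner (AdeleRing (𝓞 K) K) (Nat.le_succ m) g))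
        (fun g => W₂ (glDiagonal m (AdeleRing (𝓞 K) K) τ * g)) (fun _ => (1 : ℝ)) s) (νA.prod νK)) ∧
    ∀ {v : HeightOneSpectrum (𝓞 K)} {d : Fin (m + 1) → (v.adicCompletion K)ˣ},
      localComponent v (glDiagonal (m + 1) (AdeleRing (𝓞 K) K) (Fin.snoc τ 1)) =
        diagonalGL (Fin (m + 1)) (v.adicCompletion K) d →
      localComponent v (glDiagonal m (AdeleRing (𝓞 K) K) τ) =
        diagonalGL (Fin m) (v.adicCompletion K) fun i => d (Fin.castSucc i) := by
  intro m K _ _ _ _ νA _ _ νK _ W₁ W₂ τ s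
  exact ⟨integral_torusPairIntegrandC_corner_translate νA νK W₁ W₂ τ s,
    integrable_torusPairIntegrandC_corner_translate νA νK W₁ W₂ τ,
    fun hT => localComponent_glDiagonal_eq_of_snoc hT⟩

end Summit.Langlands.Langlands.Theorems.CornerGlobalTranslatePart1

end
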